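import Summits.AnomalousDissipation.AnomalousDissipation.Theorems.SolenoidalFractalHomogenisationLagrangianStepOneLevelScales
import Summits.AnomalousDissipation.AnomalousDissipation.Theorems.SolenoidalFractalHomogenisationLagrangianStepWindowPropagatorL
import Summits.AnomalousDissipation.AnomalousDissipation.Theorems.SolenoidalFractalHomogenisationPermissibleFractalCarrierTime
import Literature.Analysis.FluidPDE.PassiveVectorTensorTimeDilation
import Literature.Analysis.FluidPDE.LagrangianLatticeCarrier
import Summits.AnomalousDissipation.AnomalousDissipation.Theorems.SolenoidalFractalHomogenisationLagrangianStepWindowDualityE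
import Summits.AnomalousDissipation.AnomalousDissipation.Theorems.SolenoidalFractalHomogenisationLagrangianRenormalisationStepExistsL
import HarnessLib

/-!
# K1L_D (stmt-AnomalousDissipation-27980), line «onelevel-design», brick Z4♭: the window orbits of the FLAT pair ARE solutions of the cell
# clauses' problems in cell time (helper; `--supports … --as helper`; lead-k1l-onelevel-p1 g4)

Z4♭ (`Cruxes/LagrangianRenormalisationStep/Lines/onelevel_Z_bricks.lean` v5, memo L8 §2) reads the slow-vector clause (V) `SlowVectorClauseF` on ONE
grid window of the flat pair (`Um1` = cell propagator along the Eulerian lattice level `E.level (m+1)`, tensor `kbar (m+1)•S`; `Um` = carrier-free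
effective propagator, tensor `kbar m • renormStep (Φν) (gain/ν²) S`).  (V) speaks about weak solutions of the CELL problems in CELL time
`t' = a(m+1)·σ` (carrier `cellField W M hM ν _ n`, tensor `(1/n²)•𝔸`, `𝔸 = ν•S`; effective tensor `(1/n²)•(𝔸 + (c/ν)•Φν((1/ν)•𝔸))`,
carrier `0`).  THIS FILE supplies the two orbits in exactly that currency, identified a.e. with the window maps:
* `level_succ_add_grid_mul` — the level field is `refresh (m+1)`-periodic in time (`LPermissible` (W1): `refresh = r·physPeriod`), so a grid
  window `[j·refresh, …]` starts at phase `0`;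
* `smul_level_succ_comp_eq_cellField` — `(1/a) • level (m+1) (j·refresh + t'/a) = cellField W M hM ν _ N(m+1) t'` (`…OneLevelScales`);
* **`exists_cellSol_of_window`** — for `Um1` as above, a grid time `s = j·refresh (m+1) ∈ [0,1)` and a weakly divergence-free `x ∈ V2` there is a
  weak solution `w` of the (V) CELL problem on `(0, (1−s)·a)` from `x` with `toLp (w t') = Um1 s (s + t'/a) x` for a.e. `t'`;
* **`exists_effSol_of_window`** — the same for `Um` and the (V) EFFECTIVE problem (Taylor recursion, `kbar_smul_renormStep_eq_cell`).
Tools: Lions existence on the window (`Torus.exists_isWeakTensorPassiveVectorOn`), time dilation `IsWeakTensorPassiveVectorOn.comp_mul_time`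
with factor `1/a(m+1)`, `IsPropagator.repr`, `Torus.ae_Ioo_comp_mul`.
NOT a proof of Z4♭, of any registered stub, of the crux, or of AD; rung F-D1.A0.
-/

set_option linter.dupNamespace false  -- the summit-side namespace `Summit.AnomalousDissipation.AnomalousDissipation.…` repeats a component by design (D-0017)

noncomputable section

namespace Summit.AnomalousDissipation.AnomalousDissipation.Theorems.SolenoidalFractalHomogenisation.LagrangianStep.CellTime

open Literature.Analysis Literature.Analysis.FluidPDE Literature.Analysis.FluidPDE.Torus Literature.Analysis.FunctionSpaces
open MeasureTheory Set Filter UnitAddTorus Function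
open scoped ENNReal NNReal InnerProductSpace
open Literature.Analysis.FluidPDE.LatticeShear (LagrangianLatticeCarrier LatticeWord)
open Summit.AnomalousDissipation.AnomalousDissipation.Theorems.SolenoidalFractalHomogenisation.PermissibleCarrier (periodic_level isWeaklyDivFree_level)
open Summit.AnomalousDissipation.AnomalousDissipation.Theorems.SolenoidalFractalHomogenisation.LagrangianRenormalisationStep
  (cellVisc_pos' memLp_top_stLift_of_continuous continuous_uncurry_level)

variable {k : ℕ}

/-! ## Phase zero at grid times; the dilated level is the cell carrier -/

/-- Under `LPermissible` the level-`(m+1)` field is `refresh (m+1)`-periodic, so shifting time by a grid point `j·refresh (m+1)` does nothing. -/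
theorem level_succ_add_grid_mul (E : LagrangianLatticeCarrier k) (hL : E.LPermissible) (m j : ℕ) (τ : ℝ) :
    E.toFractalCarrierData.level (m + 1) ((j : ℝ) * E.refresh (m + 1) + τ) = E.toFractalCarrierData.level (m + 1) τ := by
  obtain ⟨r, -, hre⟩ := hL.refresh_periods m
  have hper : Function.Periodic (E.toFractalCarrierData.level (m + 1)) (E.refresh (m + 1)) := by
    rw [hre]; exact (periodic_level E.toFractalCarrierData (m + 1)).nat_mul r
  have h := (hper.nat_mul j) τ
  rw [show (j : ℝ) * E.refresh (m + 1) + τ = τ + j * E.refresh (m + 1) from add_comm _ _]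
  exact h

/-- **The dilated level is the cell carrier**: `(1/a) • level (m+1) (j·refresh + t'/a) = cellField W M hM (cellVisc (m+1)) _ (N (m+1)) t'`
for a carrier replaying `W.stretch M` (`E.design = W.stretch M hM`). -/
theorem smul_level_succ_comp_eq_cellField (E : LagrangianLatticeCarrier k) (hL : E.LPermissible) {W : LatticeWord k} {M : ℝ} {hM : 0 < M}
    (hdes : E.design = W.stretch M hM) (m j : ℕ) (t' : ℝ) (y : UnitAddTorus (Fin 3)) :
    (1 / E.a (m + 1)) • E.toFractalCarrierData.level (m + 1) ((j : ℝ) * E.refresh (m + 1) + 1 / E.a (m + 1) * t') y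
      = cellField W M hM (E.cellVisc (m + 1)) (cellVisc_pos' E.toFractalCarrierData (m + 1)) (E.N (m + 1)) t' y := by
  have ha : E.a (m + 1) ≠ 0 := (E.a_pos (m + 1)).ne'
  rw [level_succ_add_grid_mul E hL m j,
    level_eq_cellField E.toFractalCarrierData hdes (m + 1) (cellVisc_pos' E.toFractalCarrierData (m + 1)), smul_smul,
    show 1 / E.a (m + 1) * E.toFractalCarrierData.a (m + 1) = 1 by
      rw [show E.toFractalCarrierData.a (m + 1) = E.a (m + 1) from rfl]; field_simp,
    one_smul, show E.toFractalCarrierData.a (m + 1) * (1 / E.a (m + 1) * t') = t' by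
      rw [show E.toFractalCarrierData.a (m + 1) = E.a (m + 1) from rfl]; field_simp]

/-! ## The window orbits as cell-time solutions -/

/-- **The TRUE window orbit is a (V) cell solution in cell time.**  See the module docstring. -/
theorem exists_cellSol_of_window (E : LagrangianLatticeCarrier k) (hL : E.LPermissible) {W : LatticeWord k} {M : ℝ} {hM : 0 < M}
    (hdes : E.design = W.stretch M hM) (m : ℕ) {S : FluidPDE.Torus.Visc4 (Fin 3)} {lo hi : ℝ} (hlo : 0 < lo) (hSn : FluidPDE.Torus.NearIso S lo hi)
    {Um1 : ℝ → ℝ → (V2 →L[ℝ] V2)} (hUm1 : FluidPDE.Torus.IsPropagator 1 (E.toFractalCarrierData.level (m + 1)) (E.kbar (m + 1) • S) Um1)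
    (j : ℕ) {s : ℝ} (hsj : s = (j : ℝ) * E.refresh (m + 1)) (hs0 : 0 ≤ s) (hs1 : s < 1)
    (x : V2) (hx : FunctionSpaces.Torus.IsWeaklyDivFree (x : VF)) :
    ∃ w : ℝ → VF,
      FluidPDE.Torus.IsWeakTensorPassiveVectorOn 0 ((1 - s) / (1 / E.a (m + 1)))
        ((1 / (E.N (m + 1) : ℝ) ^ 2) • (E.cellVisc (m + 1) • S))
        (cellField W M hM (E.cellVisc (m + 1)) (cellVisc_pos' E.toFractalCarrierData (m + 1)) (E.N (m + 1))) (x : VF) w ∧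
      ∀ᵐ t' ∂(volume.restrict (Ioo 0 ((1 - s) / (1 / E.a (m + 1))))),
        ∃ ht : MemLp (w t') 2 volume, ht.toLp (w t') = Um1 s (s + 1 / E.a (m + 1) * t') x := by
  have ha : 0 < E.a (m + 1) := E.a_pos (m + 1)
  have ha' : 0 < 1 / E.a (m + 1) := one_div_pos.2 ha
  -- the level field: continuous, hence essentially bounded; divergence free (explicit lattice layers)
  have hlev : Continuous (uncurry (E.toFractalCarrierData.level (m + 1))) := continuous_uncurry_level E.toFractalCarrierData (m + 1)
  have hb : MemLp (FunctionSpaces.Torus.stLift (E.toFractalCarrierData.level (m + 1))) ∞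
      (volume.restrict (Ioo 0 1 ×ˢ (univ : Set (EuclideanSpace ℝ (Fin 3))))) := memLp_top_stLift_of_continuous hlev 1
  have hbdiv : ∀ᵐ t ∂(volume.restrict (Ioo (0:ℝ) 1)), FunctionSpaces.Torus.IsWeaklyDivFree (E.toFractalCarrierData.level (m + 1) t) :=
    ae_of_all _ fun t => isWeaklyDivFree_level E.toFractalCarrierData (m + 1) t
  -- Lions solution on the window
  have h𝔸 : FluidPDE.Torus.NearIso (E.kbar (m + 1) • S) (E.kbar (m + 1) * lo) (E.kbar (m + 1) * hi) := hSn.smul (E.kbar_pos _).le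
  obtain ⟨w₀, hw₀⟩ := FluidPDE.Torus.exists_windowSol h𝔸 (mul_pos (E.kbar_pos _) hlo) hb hbdiv hs0 hs1 (Lp.memLp x) hx
  -- dilate time by `1/a`
  have hw := hw₀.comp_mul_time ha'
  -- the dilated carrier is the cell carrier, the dilated tensor the cell tensor
  have hcar : (fun (t' : ℝ) (y : UnitAddTorus (Fin 3)) => (1 / E.a (m + 1)) • E.toFractalCarrierData.level (m + 1) (s + 1 / E.a (m + 1) * t') y)
      = cellField W M hM (E.cellVisc (m + 1)) (cellVisc_pos' E.toFractalCarrierData (m + 1)) (E.N (m + 1)) := by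
    funext t' y
    rw [hsj]
    exact smul_level_succ_comp_eq_cellField E hL hdes m j t' y
  have hten : (1 / E.a (m + 1)) • (E.kbar (m + 1) • S) = (1 / (E.N (m + 1) : ℝ) ^ 2) • (E.cellVisc (m + 1) • S) := by
    rw [show E.kbar (m + 1) • S = E.toFractalCarrierData.kbar (m + 1) • S from rfl, kbar_smul_eq_cell, smul_smul,
      show 1 / E.a (m + 1) * E.toFractalCarrierData.a (m + 1) = 1 by
        rw [show E.toFractalCarrierData.a (m + 1) = E.a (m + 1) from rfl]; field_simp, one_smul]
  rw [hcar, hten] at hw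
  refine ⟨fun t' y => w₀ (1 / E.a (m + 1) * t') y, hw, ?_⟩
  -- `repr` along the dilation
  have r := hUm1.repr s hs0 hs1 (x : VF) (Lp.memLp x) hx w₀ hw₀
  have r' := FluidPDE.Torus.ae_Ioo_comp_mul ha' r
  filter_upwards [r'] with t' ht'
  obtain ⟨hm, he⟩ := ht'
  rw [Lp.toLp_coeFn] at he
  exact ⟨hm, he⟩

/-- **The COARSE (effective) window orbit is a (V) effective solution in cell time.**  With `g = gain/ν²` and the Taylor recursion of `Permissible`,
`(1/a)•(kbar m • renormStep (Φ ν) g S) = (1/n²)•(𝔸 + (gain/ν)•Φ ν ((1/ν)•𝔸))`, `𝔸 = ν•S`. -/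
theorem exists_effSol_of_window (E : LagrangianLatticeCarrier k) (hL : E.LPermissible) (m : ℕ)
    (Φ : ℝ → FluidPDE.Torus.Visc4 (Fin 3) → FluidPDE.Torus.Visc4 (Fin 3))
    {S : FluidPDE.Torus.Visc4 (Fin 3)} {lo hi : ℝ} (hlo : 0 < lo) (hSn : FluidPDE.Torus.NearIso S lo hi)
    (hΦSn : FluidPDE.Torus.NearIso (Φ (E.cellVisc (m + 1)) S) lo hi)
    {Um : ℝ → ℝ → (V2 →L[ℝ] V2)}
    (hUm : FluidPDE.Torus.IsPropagator 1 (fun (_ : ℝ) (_ : UnitAddTorus (Fin 3)) => (0 : EuclideanSpace ℝ (Fin 3)))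
      (E.kbar m • renormStep (Φ (E.cellVisc (m + 1))) (E.gain / E.cellVisc (m + 1) ^ 2) S) Um)
    {s : ℝ} (hs0 : 0 ≤ s) (hs1 : s < 1) (x : V2) (hx : FunctionSpaces.Torus.IsWeaklyDivFree (x : VF)) :
    ∃ v : ℝ → VF,
      FluidPDE.Torus.IsWeakTensorPassiveVectorOn 0 ((1 - s) / (1 / E.a (m + 1)))
        ((1 / (E.N (m + 1) : ℝ) ^ 2) • (E.cellVisc (m + 1) • S +
          (E.gain / E.cellVisc (m + 1)) • Φ (E.cellVisc (m + 1)) ((1 / E.cellVisc (m + 1)) • (E.cellVisc (m + 1) • S))))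
        (fun (_ : ℝ) (_ : UnitAddTorus (Fin 3)) => (0 : EuclideanSpace ℝ (Fin 3))) (x : VF) v ∧
      ∀ᵐ t' ∂(volume.restrict (Ioo 0 ((1 - s) / (1 / E.a (m + 1))))),
        ∃ ht : MemLp (v t') 2 volume, ht.toLp (v t') = Um s (s + 1 / E.a (m + 1) * t') x := by
  have ha : 0 < E.a (m + 1) := E.a_pos (m + 1)
  have ha' : 0 < 1 / E.a (m + 1) := one_div_pos.2 ha
  have hg : 0 ≤ E.gain / E.cellVisc (m + 1) ^ 2 := div_nonneg E.gain_pos.le (sq_nonneg _)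
  -- the free carrier
  have hb : MemLp (FunctionSpaces.Torus.stLift (fun (_ : ℝ) (_ : UnitAddTorus (Fin 3)) => (0 : EuclideanSpace ℝ (Fin 3)))) ∞
      (volume.restrict (Ioo 0 1 ×ˢ (univ : Set (EuclideanSpace ℝ (Fin 3))))) := memLp_top_const 0
  have hbdiv : ∀ᵐ t ∂(volume.restrict (Ioo (0:ℝ) 1)),
      FunctionSpaces.Torus.IsWeaklyDivFree ((fun (_ : ℝ) (_ : UnitAddTorus (Fin 3)) => (0 : EuclideanSpace ℝ (Fin 3))) t) :=
    ae_of_all _ fun t θ hθ => by simp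
  -- the coarse tensor is elliptic
  have h𝔸 : FluidPDE.Torus.NearIso (E.kbar m • renormStep (Φ (E.cellVisc (m + 1))) (E.gain / E.cellVisc (m + 1) ^ 2) S)
      (E.kbar m * lo) (E.kbar m * hi) :=
    (WindowDuality.nearIso_renormStep' hSn hΦSn hg).smul (E.kbar_pos m).le
  obtain ⟨v₀, hv₀⟩ := FluidPDE.Torus.exists_windowSol h𝔸 (mul_pos (E.kbar_pos m) hlo) hb hbdiv hs0 hs1 (Lp.memLp x) hx
  have hv := hv₀.comp_mul_time ha'
  have hcar : (fun (t' : ℝ) (y : UnitAddTorus (Fin 3)) => (1 / E.a (m + 1)) •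
      (fun (_ : ℝ) (_ : UnitAddTorus (Fin 3)) => (0 : EuclideanSpace ℝ (Fin 3))) (s + 1 / E.a (m + 1) * t') y)
      = fun (_ : ℝ) (_ : UnitAddTorus (Fin 3)) => (0 : EuclideanSpace ℝ (Fin 3)) := by
    funext t' y; simp
  have hten : (1 / E.a (m + 1)) • (E.kbar m • renormStep (Φ (E.cellVisc (m + 1))) (E.gain / E.cellVisc (m + 1) ^ 2) S)
      = (1 / (E.N (m + 1) : ℝ) ^ 2) • (E.cellVisc (m + 1) • S +
          (E.gain / E.cellVisc (m + 1)) • Φ (E.cellVisc (m + 1)) ((1 / E.cellVisc (m + 1)) • (E.cellVisc (m + 1) • S))) := by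
    rw [show E.kbar m • renormStep (Φ (E.cellVisc (m + 1))) (E.gain / E.cellVisc (m + 1) ^ 2) S
        = E.toFractalCarrierData.kbar m • renormStep (Φ (E.toFractalCarrierData.cellVisc (m + 1)))
            (E.toFractalCarrierData.gain / E.toFractalCarrierData.cellVisc (m + 1) ^ 2) S from rfl,
      kbar_smul_renormStep_eq_cell E.toFractalCarrierData hL.permissible, smul_smul,
      show 1 / E.a (m + 1) * E.toFractalCarrierData.a (m + 1) = 1 by
        rw [show E.toFractalCarrierData.a (m + 1) = E.a (m + 1) from rfl]; field_simp, one_smul]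
  rw [hcar, hten] at hv
  refine ⟨fun t' y => v₀ (1 / E.a (m + 1) * t') y, hv, ?_⟩
  have r := hUm.repr s hs0 hs1 (x : VF) (Lp.memLp x) hx v₀ hv₀
  have r' := FluidPDE.Torus.ae_Ioo_comp_mul ha' r
  filter_upwards [r'] with t' ht'
  obtain ⟨hm, he⟩ := ht'
  rw [Lp.toLp_coeFn] at he
  exact ⟨hm, he⟩

end Summit.AnomalousDissipation.AnomalousDissipation.Theorems.SolenoidalFractalHomogenisation.LagrangianStep.CellTime

end
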